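import Literature.IUT.HodgeTheaters.PiAvatarBaseKitProp68iGroup
import Literature.IUT.HodgeTheaters.PiAvatarBaseKitThetaNFInstances
import HarnessLib

/-!
# [IUTchI] Prop 6.8 (i), the finite-GROUP / outer-isomorphism / stabiliser clause, and Prop 6.6 (ii)(iii), 6.8 (i) AS PRINTED
# (guard `Nonempty 𝕍` DISCHARGED) BY NAME at the Θ-NF kits of record `baseKitThetaNF`, `baseKitThetaNFOfBadPairs`, `baseKitThetaNFStandIn`
# (proof-only; cell abc-iut, L5, support row «P68I-GROUP@THETANF-KITS», abc-iut-L5-t13 gen 8; sequel to `PiAvatarBaseKitProp68iGroup`)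

S. Mochizuki, *Inter-universal Teichmüller theory I: construction of Hodge theaters*, kurims manuscript (May 2020), Prop 6.8 (i)
p. 167 l.38 – p. 168 l.8 («admits an `𝔽_l^{⋊±}`-symmetry — i.e., more precisely, a symmetry given by the action of a finite group that is
equipped with a natural outer isomorphism to `𝔽_l^{⋊±}` — which acts doubly transitively [i.e., transitively with stabilizers of order two]
on the index set»), Prop 6.6 (ii)(iii) p. 165, Def 3.1 (b) p. 61 («`V^bad_mod` … a nonempty set»), Ex 6.3 (ii) p. 161
[claim: Mochizuki2012, status: disputed] (D-0012 claim key; series status DISPUTED — kernel theorems about abc-iut-L5-t4's CONSTRUCTIONS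
`InitialThetaData.baseKitThetaNF*` (`PiAvatarBaseKitThetaNFInstances`) over abc-iut-L5-t2's REAL `InitialThetaData`; nothing of the series
is asserted, no side is taken on [IUTchIII] Cor. 3.12).

## Why this file
`PiAvatarBaseKitProp68iGroup` (abc-iut-L5-t13 gen 5) derived, at kit level, the Prop 6.8 (i) GROUP clause
(`PMBaseKit.DThetaPMEllHT.ellBridgeSymmetryGroup_of_negCompatModel`, `card_ellBridgeIso_of_negCompatModel`) and the UNGUARDED forms of
the three typed §6 torsor rows (`…_unguarded_of_negCompatModel`) from (β) `Ex63.NegCompatModel` + `Nonempty 𝕍`, and fired them at the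
genuine §6 kits then in tree (`baseKit`, `baseKitOfTorsionMonodromy`, `baseKitOfBadPairs`, `baseKitStandIn`, `baseKitNFStandIn`, the
certificate's unramified kit).  The NF-widened Θ-kits of D-JΘ1-2 (iv-b′) — `baseKitThetaNF B CG hS hsurj hA Λ`,
`baseKitThetaNFOfBadPairs CG hS M hA hI B ΛBad` (the kit of record of the L5 hub since abc-iut-L5-lead TOKEN EDIT v2.6, on which the
BASE-MERGE target `genuineFKit` is built) and `baseKitThetaNFStandIn CG hS M hA hI` — postdate that file: `PiAvatarBaseKitThetaNFInstances`
carries (α), (β), Prop 6.6 (ii)(iii), the GUARDED Prop 6.8 (i) (`EllBridgeSymmetry`) and Ex 6.3 (ii) at all three, but not the group clause,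
not the count `#Iso = 2·l`, and not the unguarded «as printed» conjunction.  This file supplies exactly those, BY NAME:
* `nonempty_V_baseKitThetaNF*` — the guard `Nonempty 𝕍` at the three kits (their index type is `IndexCopy`; `nonempty_indexCopy`,
  Def 3.1 (b));
* `ellBridgeSymmetryGroup_baseKitThetaNF*` (Prop 6.8 (i) group clause, UNGUARDED) and `card_ellBridgeIso_baseKitThetaNF*` (`= 2·l`);
* `sec6_torsors_asPrinted_baseKitThetaNF*` = Prop 6.6 (ii) ∧ 6.6 (iii) ∧ 6.8 (i) WITHOUT the `Nonempty 𝕍 →` guard.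
Every proof is a one-line application of the gen-5 kit-level theorems to `negCompatModel_baseKitThetaNF{,OfBadPairs,StandIn}`
(abc-iut-L5-t4 lineage, `PiAvatarBaseKitThetaNFInstances`); binders BY NAME exactly as the kit they decorate (`B CG hS hsurj hA Λ` /
`CG hS M hA hI B ΛBad` / `CG hS M hA hI`).  Tokens / NV untouched (abc-iut-L5-lead's pen; census material only).
Proof-only: no `def`, no `instance`, no `notation`, no new `Prop` fact; typed ≠ inhabited ≠ proved; a binder is an assumption label;
the bad-place `𝒟_v̲` of `baseKitThetaNFStandIn` is a profinite `X̲→`-STAND-IN and the NF half of all three kits is the labelled Θ-NF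
stand-in of D-JΘ1-2 (honesty tags of `PiAvatarBaseKitThetaNFInstances`, repeated).  HONEST FRAMING: nothing here asserts that abc is proved
or refuted; establishment = OUR kernel check only.
-/

namespace Literature.IUT.HodgeTheaters

open CategoryTheory

universe u v w

section Prop68iGroupAtThetaNFKits

variable {F : Type u} {K : Type v} {Fbar : Type w} [Field F] [NumberField F] [Field K] [NumberField K]
  [Algebra F K] [Field Fbar] [Algebra F Fbar] [Algebra K Fbar]
  {E : WeierstrassCurve F} [E.IsElliptic] {l : ℕ} {Pb : BadPlacePredicates K}
  (D : InitialThetaData F K Fbar E l Pb)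

namespace InitialThetaData

/-! ### The Θ-NF kit over `V̲`: `baseKitThetaNF B CG hS hsurj hA Λ` -/

section OverPlaces

variable (B : ∀ v, v ∈ D.indexCopyBad → D.BadPairAt v) (CG : D.geom.pe.CuspGalois) (hS : D.CuspClassesNormaliserStable) [Fact l.Prime]
  [(D.PiXund.subgroupOf D.PiXK).Normal] (hsurj : Function.Surjective D.toFlStarGlobal) (hA : D.geom.pe.ArrowCoveringClaims)
  (Λ : ∀ v, D.LocalArrowLaw CG hS (D.localGroupAt B v))

/-- The index set of the Θ-NF kit `baseKitThetaNF` is nonempty (it is `V̲`, which contains `V̲^bad ≠ ∅`).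
([IUTchI] Def 3.1 (b) p.61) [claim: Mochizuki2012, status: disputed] -/
theorem nonempty_V_baseKitThetaNF : Nonempty (D.baseKitThetaNF B CG hS hsurj hA Λ).V :=
  D.nonempty_indexCopy

/-- **[IUTchI] Prop 6.8 (i), the GROUP clause, at the Θ-NF kit `baseKitThetaNF`**: for every `𝒟-Θ^{±ell}`-Hodge theater `H` of the kit,
the symmetries of its `𝒟-Θ^{ell}`-bridge ARE the action of the finite group `Aut_±(T)` (bijection via index bijections), `Aut_±(T)` carries a
natural outer isomorphism to `𝔽_l^{⋊±}` (every chart reads it isomorphically onto `𝔽_l^{⋊±}`), and acts transitively on `T` with stabilisers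
of order two — UNGUARDED. ([IUTchI] Prop 6.8 (i) p.168) [claim: Mochizuki2012, status: disputed] -/
theorem ellBridgeSymmetryGroup_baseKitThetaNF (H : (D.baseKitThetaNF B CG hS hsurj hA Λ).DThetaPMEllHT) :
    Function.Bijective (fun g : PMBaseKit.DThetaEllBridge.Iso H.ellBridge H.ellBridge =>
        (⟨(g.indexEquiv : Equiv.Perm H.T), H.ellBridgeIso_indexEquiv_mem_autPM g⟩ : H.grpT.toTorsor.autPM)) ∧
      (∀ e ∈ H.grpT.toTorsor.charts, ∃ φ : H.grpT.toTorsor.autPM ≃* FlPM l,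
        ∀ (σ : H.grpT.toTorsor.autPM) (t : H.T), e (σ.1 t) = φ σ • e t) ∧
      MulAction.IsPretransitive H.grpT.toTorsor.autPM H.T ∧
      ∀ t : H.T, Nat.card (MulAction.stabilizer H.grpT.toTorsor.autPM t) = 2 :=
  PMBaseKit.DThetaPMEllHT.ellBridgeSymmetryGroup_of_negCompatModel (D.negCompatModel_baseKitThetaNF B CG hS hsurj hA Λ) H
    (D.nonempty_V_baseKitThetaNF B CG hS hsurj hA Λ)

/-- **[IUTchI] Prop 6.8 (i), the count, at the Θ-NF kit `baseKitThetaNF`**: `#Iso(†φ^{Θell}_±, †φ^{Θell}_±) = 2·l = |𝔽_l^{⋊±}|`.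
([IUTchI] Prop 6.8 (i) p.168) [claim: Mochizuki2012, status: disputed] -/
theorem card_ellBridgeIso_baseKitThetaNF (H : (D.baseKitThetaNF B CG hS hsurj hA Λ).DThetaPMEllHT) :
    Nat.card (PMBaseKit.DThetaEllBridge.Iso H.ellBridge H.ellBridge) = 2 * l :=
  PMBaseKit.DThetaPMEllHT.card_ellBridgeIso_of_negCompatModel (D.negCompatModel_baseKitThetaNF B CG hS hsurj hA Λ) H
    (D.nonempty_V_baseKitThetaNF B CG hS hsurj hA Λ)

/-- **[IUTchI] Prop 6.6 (ii) ∧ 6.6 (iii) ∧ 6.8 (i) AS PRINTED at the Θ-NF kit `baseKitThetaNF`** — the three typed torsor rows WITHOUT the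
`Nonempty 𝕍 →` guard of `PMBaseBridgeProps` / `PMBaseProcessions` (the guard is the theorem `nonempty_V_baseKitThetaNF`).
([IUTchI] Prop 6.6 (ii) p.165) [claim: Mochizuki2012, status: disputed] -/
theorem sec6_torsors_asPrinted_baseKitThetaNF :
    (∀ B₁ B₂ : (D.baseKitThetaNF B CG hS hsurj hA Λ).DThetaEllBridge,
      Nonempty (PMBaseKit.DThetaEllBridge.Iso B₁ B₂) ∧
        Function.Bijective fun g : PMBaseKit.DThetaEllBridge.Iso B₁ B₂ =>
          (⟨g.indexEquiv, g.indexEquiv_charts⟩ : {ι : B₁.T ≃ B₂.T // B₁.torT.Compat B₂.torT ι})) ∧  -- IUTchI:Prop6.6(ii)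
    (∀ H₁ H₂ : (D.baseKitThetaNF B CG hS hsurj hA Λ).DThetaPMEllHT,
      Nonempty (PMBaseKit.DThetaPMEllHT.Iso H₁ H₂) ∧
        Function.Bijective fun g : PMBaseKit.DThetaPMEllHT.Iso H₁ H₂ =>
          (⟨g.pmIso.indexEquiv, g.pmIso.indexEquiv_charts⟩ : {ι : H₁.T ≃ H₂.T // H₁.grpT.Compat H₂.grpT ι})) ∧  -- IUTchI:Prop6.6(iii)
    (∀ H : (D.baseKitThetaNF B CG hS hsurj hA Λ).DThetaPMEllHT,
      (∀ t₁ t₂ : H.T, ∃ g : PMBaseKit.DThetaEllBridge.Iso H.ellBridge H.ellBridge, g.indexEquiv t₁ = t₂) ∧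
        Nat.card (PMBaseKit.DThetaEllBridge.Iso H.ellBridge H.ellBridge) = 2 * Nat.card H.T) :=  -- IUTchI:Prop6.8(i)
  ⟨PMBaseKit.DThetaEllBridge.isoTorsor_unguarded_of_negCompatModel (D.negCompatModel_baseKitThetaNF B CG hS hsurj hA Λ)
      (D.nonempty_V_baseKitThetaNF B CG hS hsurj hA Λ),
    PMBaseKit.DThetaPMEllHT.isoTorsor_unguarded_of_negCompatModel (D.negCompatModel_baseKitThetaNF B CG hS hsurj hA Λ)
      (D.nonempty_V_baseKitThetaNF B CG hS hsurj hA Λ),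
    PMBaseKit.DThetaPMEllHT.ellBridgeSymmetry_unguarded_of_negCompatModel (D.negCompatModel_baseKitThetaNF B CG hS hsurj hA Λ)
      (D.nonempty_V_baseKitThetaNF B CG hS hsurj hA Λ)⟩

end OverPlaces

/-! ### The genuine-shape Θ-NF kit from a torsion monodromy: `baseKitThetaNFOfBadPairs CG hS M hA hI B ΛBad` (kit of record) -/

variable (CG : D.geom.pe.CuspGalois) (hS : D.CuspClassesNormaliserStable) [Fact l.Prime]
  (M : D.TorsionMonodromy) (hA : D.geom.pe.ArrowCoveringClaims)
  (hI : ∀ k ∈ D.geom.pe.inertia D.geom.pe.ε1, M.tau (D.geom.embK k) = 0)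

section Genuine

variable (B : ∀ v, v ∈ D.indexCopyBad → D.BadPairAt v) (ΛBad : ∀ v (h : v ∈ D.indexCopyBad), D.LocalArrowLaw CG hS (B v h).H)

/-- The index set of the kit of record `baseKitThetaNFOfBadPairs` is nonempty (it is `V̲ ⊇ V̲^bad ≠ ∅`).
([IUTchI] Def 3.1 (b) p.61) [claim: Mochizuki2012, status: disputed] -/
theorem nonempty_V_baseKitThetaNFOfBadPairs : Nonempty (D.baseKitThetaNFOfBadPairs CG hS M hA hI B ΛBad).V :=
  D.nonempty_indexCopy

/-- **[IUTchI] Prop 6.8 (i), the GROUP clause, at the kit of record `baseKitThetaNFOfBadPairs`** (binders `CG hS M hA hI`, bad-pair DATA `B`,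
laws `ΛBad`): the symmetries of the `𝒟-Θ^{ell}`-bridge of any `𝒟-Θ^{±ell}`-Hodge theater `H` of the kit ARE the finite group `Aut_±(T)`, every
chart reads `Aut_±(T)` isomorphically onto `𝔽_l^{⋊±}` (natural outer isomorphism), transitive on `T` with stabilisers of order two — UNGUARDED.
([IUTchI] Prop 6.8 (i) p.168) [claim: Mochizuki2012, status: disputed] -/
theorem ellBridgeSymmetryGroup_baseKitThetaNFOfBadPairs (H : (D.baseKitThetaNFOfBadPairs CG hS M hA hI B ΛBad).DThetaPMEllHT) :
    Function.Bijective (fun g : PMBaseKit.DThetaEllBridge.Iso H.ellBridge H.ellBridge =>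
        (⟨(g.indexEquiv : Equiv.Perm H.T), H.ellBridgeIso_indexEquiv_mem_autPM g⟩ : H.grpT.toTorsor.autPM)) ∧
      (∀ e ∈ H.grpT.toTorsor.charts, ∃ φ : H.grpT.toTorsor.autPM ≃* FlPM l,
        ∀ (σ : H.grpT.toTorsor.autPM) (t : H.T), e (σ.1 t) = φ σ • e t) ∧
      MulAction.IsPretransitive H.grpT.toTorsor.autPM H.T ∧
      ∀ t : H.T, Nat.card (MulAction.stabilizer H.grpT.toTorsor.autPM t) = 2 :=
  PMBaseKit.DThetaPMEllHT.ellBridgeSymmetryGroup_of_negCompatModel (D.negCompatModel_baseKitThetaNFOfBadPairs CG hS M hA hI B ΛBad) H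
    (D.nonempty_V_baseKitThetaNFOfBadPairs CG hS M hA hI B ΛBad)

/-- **[IUTchI] Prop 6.8 (i), the count, at the kit of record `baseKitThetaNFOfBadPairs`**: `#Iso = 2·l = |𝔽_l^{⋊±}|`.
([IUTchI] Prop 6.8 (i) p.168) [claim: Mochizuki2012, status: disputed] -/
theorem card_ellBridgeIso_baseKitThetaNFOfBadPairs (H : (D.baseKitThetaNFOfBadPairs CG hS M hA hI B ΛBad).DThetaPMEllHT) :
    Nat.card (PMBaseKit.DThetaEllBridge.Iso H.ellBridge H.ellBridge) = 2 * l :=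
  PMBaseKit.DThetaPMEllHT.card_ellBridgeIso_of_negCompatModel (D.negCompatModel_baseKitThetaNFOfBadPairs CG hS M hA hI B ΛBad) H
    (D.nonempty_V_baseKitThetaNFOfBadPairs CG hS M hA hI B ΛBad)

/-- **[IUTchI] Prop 6.6 (ii) ∧ 6.6 (iii) ∧ 6.8 (i) AS PRINTED (unguarded) at the kit of record `baseKitThetaNFOfBadPairs`.**
([IUTchI] Prop 6.6 (iii) p.165) [claim: Mochizuki2012, status: disputed] -/
theorem sec6_torsors_asPrinted_baseKitThetaNFOfBadPairs :
    (∀ B₁ B₂ : (D.baseKitThetaNFOfBadPairs CG hS M hA hI B ΛBad).DThetaEllBridge,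
      Nonempty (PMBaseKit.DThetaEllBridge.Iso B₁ B₂) ∧
        Function.Bijective fun g : PMBaseKit.DThetaEllBridge.Iso B₁ B₂ =>
          (⟨g.indexEquiv, g.indexEquiv_charts⟩ : {ι : B₁.T ≃ B₂.T // B₁.torT.Compat B₂.torT ι})) ∧  -- IUTchI:Prop6.6(ii)
    (∀ H₁ H₂ : (D.baseKitThetaNFOfBadPairs CG hS M hA hI B ΛBad).DThetaPMEllHT,
      Nonempty (PMBaseKit.DThetaPMEllHT.Iso H₁ H₂) ∧
        Function.Bijective fun g : PMBaseKit.DThetaPMEllHT.Iso H₁ H₂ =>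
          (⟨g.pmIso.indexEquiv, g.pmIso.indexEquiv_charts⟩ : {ι : H₁.T ≃ H₂.T // H₁.grpT.Compat H₂.grpT ι})) ∧  -- IUTchI:Prop6.6(iii)
    (∀ H : (D.baseKitThetaNFOfBadPairs CG hS M hA hI B ΛBad).DThetaPMEllHT,
      (∀ t₁ t₂ : H.T, ∃ g : PMBaseKit.DThetaEllBridge.Iso H.ellBridge H.ellBridge, g.indexEquiv t₁ = t₂) ∧
        Nat.card (PMBaseKit.DThetaEllBridge.Iso H.ellBridge H.ellBridge) = 2 * Nat.card H.T) :=  -- IUTchI:Prop6.8(i)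
  ⟨PMBaseKit.DThetaEllBridge.isoTorsor_unguarded_of_negCompatModel
      (D.negCompatModel_baseKitThetaNFOfBadPairs CG hS M hA hI B ΛBad) (D.nonempty_V_baseKitThetaNFOfBadPairs CG hS M hA hI B ΛBad),
    PMBaseKit.DThetaPMEllHT.isoTorsor_unguarded_of_negCompatModel
      (D.negCompatModel_baseKitThetaNFOfBadPairs CG hS M hA hI B ΛBad) (D.nonempty_V_baseKitThetaNFOfBadPairs CG hS M hA hI B ΛBad),
    PMBaseKit.DThetaPMEllHT.ellBridgeSymmetry_unguarded_of_negCompatModel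
      (D.negCompatModel_baseKitThetaNFOfBadPairs CG hS M hA hI B ΛBad) (D.nonempty_V_baseKitThetaNFOfBadPairs CG hS M hA hI B ΛBad)⟩

end Genuine

/-! ### The Θ-NF kit at the `X̲→`-stand-in: `baseKitThetaNFStandIn CG hS M hA hI` -/

/-- The index set of the Θ-NF stand-in kit `baseKitThetaNFStandIn` is nonempty (it is `V̲ ⊇ V̲^bad ≠ ∅`).
([IUTchI] Def 3.1 (b) p.61) [claim: Mochizuki2012, status: disputed] -/
theorem nonempty_V_baseKitThetaNFStandIn : Nonempty (D.baseKitThetaNFStandIn CG hS M hA hI).V :=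
  D.nonempty_indexCopy

/-- **[IUTchI] Prop 6.8 (i), the GROUP clause, at the Θ-NF stand-in kit `baseKitThetaNFStandIn`** (binders `CG hS M hA hI`; honesty tag:
the bad-place `𝒟_v̲` there is the profinite `X̲→`-STAND-IN, NOT print's `ℬ^temp(X̳_v̲)⁰`). ([IUTchI] Prop 6.8 (i) p.168) [claim: Mochizuki2012, status: disputed] -/
theorem ellBridgeSymmetryGroup_baseKitThetaNFStandIn (H : (D.baseKitThetaNFStandIn CG hS M hA hI).DThetaPMEllHT) :
    Function.Bijective (fun g : PMBaseKit.DThetaEllBridge.Iso H.ellBridge H.ellBridge =>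
        (⟨(g.indexEquiv : Equiv.Perm H.T), H.ellBridgeIso_indexEquiv_mem_autPM g⟩ : H.grpT.toTorsor.autPM)) ∧
      (∀ e ∈ H.grpT.toTorsor.charts, ∃ φ : H.grpT.toTorsor.autPM ≃* FlPM l,
        ∀ (σ : H.grpT.toTorsor.autPM) (t : H.T), e (σ.1 t) = φ σ • e t) ∧
      MulAction.IsPretransitive H.grpT.toTorsor.autPM H.T ∧
      ∀ t : H.T, Nat.card (MulAction.stabilizer H.grpT.toTorsor.autPM t) = 2 :=
  PMBaseKit.DThetaPMEllHT.ellBridgeSymmetryGroup_of_negCompatModel (D.negCompatModel_baseKitThetaNFStandIn CG hS M hA hI) H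
    (D.nonempty_V_baseKitThetaNFStandIn CG hS M hA hI)

/-- **[IUTchI] Prop 6.8 (i), the count, at the Θ-NF stand-in kit `baseKitThetaNFStandIn`**: `#Iso = 2·l`.
([IUTchI] Prop 6.8 (i) p.168) [claim: Mochizuki2012, status: disputed] -/
theorem card_ellBridgeIso_baseKitThetaNFStandIn (H : (D.baseKitThetaNFStandIn CG hS M hA hI).DThetaPMEllHT) :
    Nat.card (PMBaseKit.DThetaEllBridge.Iso H.ellBridge H.ellBridge) = 2 * l :=
  PMBaseKit.DThetaPMEllHT.card_ellBridgeIso_of_negCompatModel (D.negCompatModel_baseKitThetaNFStandIn CG hS M hA hI) H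
    (D.nonempty_V_baseKitThetaNFStandIn CG hS M hA hI)

/-- **[IUTchI] Prop 6.6 (ii) ∧ 6.6 (iii) ∧ 6.8 (i) AS PRINTED (unguarded) at the Θ-NF stand-in kit `baseKitThetaNFStandIn`.**
([IUTchI] Prop 6.8 (i) p.168) [claim: Mochizuki2012, status: disputed] -/
theorem sec6_torsors_asPrinted_baseKitThetaNFStandIn :
    (∀ B₁ B₂ : (D.baseKitThetaNFStandIn CG hS M hA hI).DThetaEllBridge,
      Nonempty (PMBaseKit.DThetaEllBridge.Iso B₁ B₂) ∧
        Function.Bijective fun g : PMBaseKit.DThetaEllBridge.Iso B₁ B₂ =>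
          (⟨g.indexEquiv, g.indexEquiv_charts⟩ : {ι : B₁.T ≃ B₂.T // B₁.torT.Compat B₂.torT ι})) ∧  -- IUTchI:Prop6.6(ii)
    (∀ H₁ H₂ : (D.baseKitThetaNFStandIn CG hS M hA hI).DThetaPMEllHT,
      Nonempty (PMBaseKit.DThetaPMEllHT.Iso H₁ H₂) ∧
        Function.Bijective fun g : PMBaseKit.DThetaPMEllHT.Iso H₁ H₂ =>
          (⟨g.pmIso.indexEquiv, g.pmIso.indexEquiv_charts⟩ : {ι : H₁.T ≃ H₂.T // H₁.grpT.Compat H₂.grpT ι})) ∧  -- IUTchI:Prop6.6(iii)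
    (∀ H : (D.baseKitThetaNFStandIn CG hS M hA hI).DThetaPMEllHT,
      (∀ t₁ t₂ : H.T, ∃ g : PMBaseKit.DThetaEllBridge.Iso H.ellBridge H.ellBridge, g.indexEquiv t₁ = t₂) ∧
        Nat.card (PMBaseKit.DThetaEllBridge.Iso H.ellBridge H.ellBridge) = 2 * Nat.card H.T) :=  -- IUTchI:Prop6.8(i)
  ⟨PMBaseKit.DThetaEllBridge.isoTorsor_unguarded_of_negCompatModel (D.negCompatModel_baseKitThetaNFStandIn CG hS M hA hI)
      (D.nonempty_V_baseKitThetaNFStandIn CG hS M hA hI),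
    PMBaseKit.DThetaPMEllHT.isoTorsor_unguarded_of_negCompatModel (D.negCompatModel_baseKitThetaNFStandIn CG hS M hA hI)
      (D.nonempty_V_baseKitThetaNFStandIn CG hS M hA hI),
    PMBaseKit.DThetaPMEllHT.ellBridgeSymmetry_unguarded_of_negCompatModel (D.negCompatModel_baseKitThetaNFStandIn CG hS M hA hI)
      (D.nonempty_V_baseKitThetaNFStandIn CG hS M hA hI)⟩

end InitialThetaData

end Prop68iGroupAtThetaNFKits

end Literature.IUT.HodgeTheaters
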